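import Mathlib.Analysis.SpecialFunctions.Pow.Real
import HarnessLib

/-!
# QUANT lane R8, front "FAR beyond trees", layer one — A TWO-RELAY EAR AT THE OBSERVER, III: the bookkeeping inequality

builds on p205010 (kernel theorem, internal audit signed; external expert review pending)

Support file (`--supports stmt-CriticalPhenomena-4575`), seat `prim-quant-p1` (gen 26); memo
`run/shared/lean/prim/quant/prim-quant-p1-g26/FOR-LEAD-EAR-AT-OBSERVER.md` §3.  Pure real algebra; standard axioms; no sorries; no definitions.

The data (file II, `…QuantFarEarAtObserverLaw`): ear weights `p = w(o,v)`, `r = w(v,u)`; off-`v` probabilities `x₀ = P(K₁ = 0)`,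
`x₁ = P(¬G, K₁ ≤ 1)`, `x₂ = P(K₁ ≤ 1)`, `g = P(G)`, `y = P(¬G, K₁ = 1)`, `z = P(K₁ ≥ 2)`, `z' = P(¬G, K₁ ≥ 1)` with their linear relations;
the first moments `EK = Σ_{b∈A'} P(o ~ b off v) ≤ y + n'z`, `EF = Σ_{b∈A'} P(o ≁ b, u ~ b off v) ≤ n'x₀ + (n'−1)z'` (`n' = |A'| ≥ 1`);
the marginals `q_v = p + (1−p)rg`, `q_u = pr + (1−pr)g`, `Σ_b q_b = EK + pr·EF`; a common lower bound `m` of all marginals; the mean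
hypothesis `q_u + q_v + EK + pr·EF > 2`.  CONCLUSION (`EarAtObserver.arith`): `m ≤ P(N ≥ 2) = 1 − [p(1−r)x₀ + (1−p)r x₁ + (1−p)(1−r)x₂]`.

PROOF (two regimes; cells `x = x₀`, `a₁ = x₁ − x₀`, `c = x₂ − x₁`, `d = g − c`, `a₂ = 1 − g − x₁`, so that
`P(N≥2) = pr·x + p·a₁ + a₂ + (p+r−pr)c + d`):
* regime A (`n'p ≥ (1−p)(1−pr)`, NO mean hypothesis): either `P(N≥2) ≥ q_u` (`q_u − P = (1−p)(1−r)c − p(1−r)a₁ − (1−pr)a₂ =: D`), or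
  else `n'·P(N≥2) ≥ EK + pr·EF ≥ n'm` by the identity
  `(1−p)(1−r)·Q = a₁(1−r)[n'p − (1−p)(1−pr)] + a₂[n'(p(1−r)+r(1−p)) + pr(1−p)(1−r)] + n'(p+r−pr)·D` (`Q` the deficit, `D > 0`);
* regime B (`n'p < (1−p)(1−pr)`): `(2 − p − (n'+1)pr)·(P(N≥2) − q_v) ≥ p(1−r)·(EN − 2) > 0`, coefficientwise in the cells.
[this work]
-/

namespace Summit.CriticalPhenomena.PercolationContinuityZ3.Theorems

namespace Quant

namespace EarAtObserver

/-- Regime B, condition (ii): `2 − p(n+2)(1 + r(1−p)) ≥ 0` when `np < (1−p)(1−pr)`, `0 ≤ p ≤ 1`, `0 ≤ r ≤ 1`, `n ≥ 1`. [this work] -/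
theorem regimeB_ii (p r : ℝ) (n : ℕ) (hn : 1 ≤ n) (hp0 : 0 ≤ p) (hp1 : p ≤ 1) (hr0 : 0 ≤ r) (hr1 : r ≤ 1)
    (hB : (n : ℝ) * p < (1 - p) * (1 - p * r)) : 0 ≤ 2 - p * (n + 2) * (1 + r * (1 - p)) := by
  have hn1 : (1 : ℝ) ≤ n := by exact_mod_cast hn
  have hpr0 : 0 ≤ p * r := mul_nonneg hp0 hr0
  have hpr : p * r ≤ p := by nlinarith
  have hh : (1 - p) * (1 - p * r) ≤ (1 - p) * 1 := mul_le_mul_of_nonneg_left (by linarith) (by linarith)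
  have hnp : p ≤ (n : ℝ) * p := by nlinarith
  have hp12 : p < 1 - p := by linarith
  -- `p(n+2) ≤ (1−p)(1−pr) + 2p`
  have h1 : p * (n + 2) ≤ (1 - p) * (1 - p * r) + 2 * p := by nlinarith
  have hpos : 0 ≤ 1 + r * (1 - p) := by nlinarith
  have h2 : p * (n + 2) * (1 + r * (1 - p)) ≤ ((1 - p) * (1 - p * r) + 2 * p) * (1 + r * (1 - p)) :=
    mul_le_mul_of_nonneg_right h1 hpos
  have hid : 2 - ((1 - p) * (1 - p * r) + 2 * p) * (1 + r * (1 - p)) = (1 - r + p * r) * (1 - p * (1 + r - p * r)) := by ring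
  have hf1 : 0 ≤ 1 - r + p * r := by linarith
  have hf2 : 0 ≤ 1 - p * (1 + r - p * r) := by nlinarith
  have := mul_nonneg hf1 hf2
  linarith

/-- Regime B, condition (iii): `(2 − p − (n+1)pr)(1−p) ≥ p(1−r)(n − 2 + p + npr)` when `np < (1−p)(1−pr)`. [this work] -/
theorem regimeB_iii (p r : ℝ) (n : ℕ) (hp0 : 0 ≤ p) (hp1 : p ≤ 1) (hr0 : 0 ≤ r) (hr1 : r ≤ 1)
    (hB : (n : ℝ) * p < (1 - p) * (1 - p * r)) :
    p * (1 - r) * (n - 2 + p + n * p * r) ≤ (2 - p - (n + 1) * p * r) * (1 - p) := by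
  have hpr0 : 0 ≤ p * r := mul_nonneg hp0 hr0
  have hpr1 : p * r ≤ 1 := by nlinarith
  have h0 : 0 ≤ (1 - p) * (1 - p * r) := mul_nonneg (by linarith) (by linarith)
  have hnp : (n : ℝ) * p ≤ (1 - p) * (1 - p * r) := hB.le
  have hnpr : (n : ℝ) * p * (p * r) ≤ (1 - p) * (1 - p * r) * (p * r) := mul_le_mul_of_nonneg_right hnp hpr0
  have hnr : (n : ℝ) * p * r ≤ (1 - p) * (1 - p * r) * r := mul_le_mul_of_nonneg_right hnp hr0
  -- left side ≤ (1−r)(h − 2p + p² + h·pr) ≤ (1−r) h (1 + pr)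
  have l1 : p * (1 - r) * (n - 2 + p + n * p * r) = (1 - r) * ((n * p) - 2 * p + p * p + (n * p) * (p * r)) := by ring
  have l2 : (n * p : ℝ) - 2 * p + p * p + (n * p) * (p * r) ≤ (1 - p) * (1 - p * r) * (1 + p * r) := by nlinarith
  have l3 : (1 - r) * ((n * p : ℝ) - 2 * p + p * p + (n * p) * (p * r)) ≤ (1 - r) * ((1 - p) * (1 - p * r) * (1 + p * r)) :=
    mul_le_mul_of_nonneg_left l2 (by linarith)
  -- right side ≥ (1−p)(2 − p − h r − p r)
  have r0 : (n + 1 : ℝ) * p * r = n * p * r + p * r := by ring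
  have r1 : (1 - p) * (2 - p - (1 - p) * (1 - p * r) * r - p * r) ≤ (2 - p - (n + 1) * p * r) * (1 - p) := by
    rw [r0]
    have : (2 - p - (1 - p) * (1 - p * r) * r - p * r) ≤ 2 - p - (n * p * r + p * r) := by linarith
    have := mul_le_mul_of_nonneg_left this (by linarith : (0 : ℝ) ≤ 1 - p)
    linarith
  -- the gap
  have hid : (1 - p) * (2 - p - (1 - p) * (1 - p * r) * r - p * r) - (1 - r) * ((1 - p) * (1 - p * r) * (1 + p * r)) =
      (1 - p) * ((1 - p) + p * r ^ 2 * (1 - p * r)) := by ring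
  have hgap : 0 ≤ (1 - p) * ((1 - p) + p * r ^ 2 * (1 - p * r)) := by
    apply mul_nonneg (by linarith)
    have : 0 ≤ p * r ^ 2 * (1 - p * r) := mul_nonneg (mul_nonneg hp0 (sq_nonneg r)) (by linarith)
    linarith
  linarith

/-- **The bookkeeping inequality** (see the module docstring for the data and the two-regime proof). [this work] -/
theorem arith (p r x₀ x₁ x₂ g y z z' EK EF m : ℝ) (n : ℕ) (hn : 1 ≤ n)
    (hp0 : 0 ≤ p) (hp1 : p ≤ 1) (hr0 : 0 ≤ r) (hr1 : r ≤ 1)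
    (hy0 : 0 ≤ y)
    (hy : y + x₀ = x₁) (hz : z + x₂ = 1) (hz' : z' + x₀ + g = 1)
    (h12 : x₁ ≤ x₂) (h2g : x₂ ≤ x₁ + g) (h1g : x₁ + g ≤ 1)
    (hEK : EK ≤ y + n * z) (hEF : EF ≤ n * x₀ + (n - 1) * z')
    (hmv : m ≤ p + (1 - p) * r * g) (hmu : m ≤ p * r + (1 - p * r) * g) (hmb : n * m ≤ EK + p * r * EF)
    (hEN : 2 < (p * r + (1 - p * r) * g) + (p + (1 - p) * r * g) + (EK + p * r * EF)) :
    m ≤ 1 - (p * (1 - r) * x₀ + (1 - p) * r * x₁ + (1 - p) * (1 - r) * x₂) := by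
  -- cells
  obtain ⟨a₁, ha₁⟩ : ∃ a₁ : ℝ, a₁ = x₁ - x₀ := ⟨_, rfl⟩
  obtain ⟨c, hc⟩ : ∃ c : ℝ, c = x₂ - x₁ := ⟨_, rfl⟩
  obtain ⟨d, hd⟩ : ∃ d : ℝ, d = g - (x₂ - x₁) := ⟨_, rfl⟩
  obtain ⟨a₂, ha₂⟩ : ∃ a₂ : ℝ, a₂ = 1 - g - x₁ := ⟨_, rfl⟩
  have ha₁0 : 0 ≤ a₁ := by rw [ha₁]; linarith
  have hc0 : 0 ≤ c := by rw [hc]; linarith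
  have hd0 : 0 ≤ d := by rw [hd]; linarith
  have ha₂0 : 0 ≤ a₂ := by rw [ha₂]; linarith
  have hn1 : (1 : ℝ) ≤ n := by exact_mod_cast hn
  have hnpos : (0 : ℝ) < n := by linarith
  have hpr0 : 0 ≤ p * r := mul_nonneg hp0 hr0
  have hpr1 : p * r ≤ 1 := by nlinarith
  obtain ⟨P, hP⟩ : ∃ P : ℝ, P = p * r * x₀ + p * a₁ + a₂ + (p + r - p * r) * c + d := ⟨_, rfl⟩
  have hPeq : 1 - (p * (1 - r) * x₀ + (1 - p) * r * x₁ + (1 - p) * (1 - r) * x₂) = P := by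
    rw [hP, ha₁, hc, hd, ha₂]; ring
  rw [hPeq]
  -- moments in cells
  have hya : y = a₁ := by rw [ha₁]; linarith
  have hza : z = a₂ + d := by rw [ha₂, hd]; linarith
  have hz'a : z' = a₁ + a₂ := by rw [ha₁, ha₂]; linarith
  have hg : g = c + d := by rw [hc, hd]; ring
  have hone : x₀ + a₁ + a₂ + c + d = 1 := by rw [ha₁, ha₂, hc, hd]; ring
  have hEK' : EK ≤ a₁ + n * (a₂ + d) := by rw [← hya, ← hza]; exact hEK
  have hEF' : EF ≤ n * x₀ + (n - 1) * (a₁ + a₂) := by rw [← hz'a]; exact hEF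
  -- the common upper bound for `Σ_b q_b = EK + pr EF`
  have hub : EK + p * r * EF ≤ a₁ + n * (a₂ + d) + p * r * (n * x₀ + (n - 1) * (a₁ + a₂)) := by
    have := mul_le_mul_of_nonneg_left hEF' hpr0
    linarith
  by_cases hA : (1 - p) * (1 - p * r) ≤ n * p
  · -- REGIME A: `P ≥ q_u` or `n P ≥ EK + pr EF ≥ n m`
    by_cases hu : p * r + (1 - p * r) * g ≤ P
    · exact hmu.trans hu
    · have hu' : P < p * r + (1 - p * r) * g := lt_of_not_ge hu
      -- `D = q_u − P > 0`
      obtain ⟨D, hDdef⟩ : ∃ D : ℝ, D = (1 - p) * (1 - r) * c - p * (1 - r) * a₁ - (1 - p * r) * a₂ := ⟨_, rfl⟩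
      have hDeq : p * r + (1 - p * r) * g - P = D := by
        have e : p * r + (1 - p * r) * g - P - D = p * r * (1 - (x₀ + a₁ + a₂ + c + d)) := by
          rw [hDdef, hP, hg]; ring
        rw [hone, sub_self, mul_zero] at e
        linarith only [e]
      have hDpos : 0 < D := by rw [← hDeq]; linarith only [hu']
      -- hence `(1−p)(1−r) > 0`
      have e1 : 0 ≤ p * (1 - r) * a₁ := mul_nonneg (mul_nonneg hp0 (by linarith)) ha₁0
      have e2 : 0 ≤ (1 - p * r) * a₂ := mul_nonneg (by linarith) ha₂0
      have hk0 : 0 ≤ (1 - p) * (1 - r) := mul_nonneg (by linarith) (by linarith)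
      have hpr_pos : 0 < (1 - p) * (1 - r) := by
        rcases hk0.lt_or_eq with h | h
        · exact h
        · exfalso
          have hD' : D = 0 * c - p * (1 - r) * a₁ - (1 - p * r) * a₂ := by rw [hDdef, ← h]
          rw [zero_mul] at hD'
          linarith only [hD', hDpos, e1, e2]
      -- the deficit `Q = nP − (bound on EK + pr EF)`
      obtain ⟨Q, hQ⟩ : ∃ Q : ℝ, Q = n * P - (a₁ + n * (a₂ + d) + p * r * (n * x₀ + (n - 1) * (a₁ + a₂))) := ⟨_, rfl⟩
      have hQid : (1 - p) * (1 - r) * Q = a₁ * ((1 - r) * (n * p - (1 - p) * (1 - p * r))) +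
          a₂ * (n * (p * (1 - r) + r * (1 - p)) + p * r * ((1 - p) * (1 - r))) + n * (p + r - p * r) * D := by
        rw [hQ, hDdef, hP]; ring
      have t1 : 0 ≤ a₁ * ((1 - r) * (n * p - (1 - p) * (1 - p * r))) :=
        mul_nonneg ha₁0 (mul_nonneg (by linarith) (by linarith))
      have t2 : 0 ≤ a₂ * (n * (p * (1 - r) + r * (1 - p)) + p * r * ((1 - p) * (1 - r))) := by
        apply mul_nonneg ha₂0
        have s1 : 0 ≤ p * (1 - r) + r * (1 - p) := add_nonneg (mul_nonneg hp0 (by linarith)) (mul_nonneg hr0 (by linarith))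
        exact add_nonneg (mul_nonneg hnpos.le s1) (mul_nonneg hpr0 hk0)
      have t3 : 0 ≤ (n : ℝ) * (p + r - p * r) * D := by
        have e : p + r - p * r = p * (1 - r) + r := by ring
        have : 0 ≤ p + r - p * r := by rw [e]; exact add_nonneg (mul_nonneg hp0 (by linarith only [hr1])) hr0
        exact mul_nonneg (mul_nonneg hnpos.le this) hDpos.le
      have hQnn : 0 ≤ Q := by
        have : 0 ≤ (1 - p) * (1 - r) * Q := by rw [hQid]; linarith only [t1, t2, t3]
        exact (mul_nonneg_iff_of_pos_left hpr_pos).mp this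
      -- `n m ≤ EK + pr EF ≤ bound ≤ n P`
      have hnm : (n : ℝ) * m ≤ n * P := by rw [hQ] at hQnn; linarith only [hQnn, hub, hmb]
      exact le_of_mul_le_mul_left hnm hnpos
  · -- REGIME B: `P ≥ q_v`
    have hB : (n : ℝ) * p < (1 - p) * (1 - p * r) := lt_of_not_ge hA
    refine hmv.trans ?_
    obtain ⟨Dn, hDn⟩ : ∃ Dn : ℝ, Dn = 2 - p - (n + 1) * p * r := ⟨_, rfl⟩
    have hh0 : 0 ≤ (1 - p) * (1 - p * r) := mul_nonneg (by linarith) (by linarith)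
    have hh1 : (1 - p) * (1 - p * r) ≤ (1 - p) * 1 := mul_le_mul_of_nonneg_left (by linarith) (by linarith)
    have hnp1 : p ≤ (n : ℝ) * p := by nlinarith
    have hp12 : p < 1 - p := by linarith
    have hnr : (n : ℝ) * p * r ≤ (1 - p) * (1 - p * r) * r := mul_le_mul_of_nonneg_right hB.le hr0
    have hhr : (1 - p) * (1 - p * r) * r ≤ (1 - p) * (1 - p * r) * 1 := mul_le_mul_of_nonneg_left hr1 hh0
    have hn1r : (n + 1 : ℝ) * p * r = n * p * r + p * r := by ring
    have hprp : p * r ≤ p * 1 := mul_le_mul_of_nonneg_left hr1 hp0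
    -- `Dn > 0`
    have hDnpos : 0 < Dn := by rw [hDn, hn1r]; linarith only [hnr, hhr, hh1, hp12, hprp]
    -- `EN ≤ ENub`
    obtain ⟨ENub, hENub⟩ : ∃ E : ℝ, E = (p * r + (1 - p * r) * g) + (p + (1 - p) * r * g) +
        (a₁ + n * (a₂ + d) + p * r * (n * x₀ + (n - 1) * (a₁ + a₂))) := ⟨_, rfl⟩
    have hENle : (p * r + (1 - p * r) * g) + (p + (1 - p) * r * g) + (EK + p * r * EF) ≤ ENub := by
      rw [hENub]; linarith only [hub]
    -- coefficientwise identity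
    have hid : Dn * (P - (p + (1 - p) * r * g)) - p * (1 - r) * (ENub - 2) =
        a₁ * (p * (1 - r) * (1 - p - n * p * r)) + a₂ * (Dn * (1 - p) - p * (1 - r) * (n - 2 + p + n * p * r)) +
        c * (p * (1 - r) * (1 - p) * (1 - r)) + d * (Dn * (1 - p) * (1 - r) - p * (1 - r) * (n - 1 + p + r - p * r)) := by
      rw [hENub, hP, hDn, hg]
      linear_combination (p * ((2 - p - (n + 1) * p * r) - (1 - r) * (2 - p - p * r))) * hone
    -- signs of the four coefficients
    have c1 : 0 ≤ p * (1 - r) * (1 - p - n * p * r) :=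
      mul_nonneg (mul_nonneg hp0 (by linarith only [hr1])) (by linarith only [hnr, hhr, hh1])
    have c2 : 0 ≤ Dn * (1 - p) - p * (1 - r) * (n - 2 + p + n * p * r) := by
      have := regimeB_iii p r n hp0 hp1 hr0 hr1 hB
      rw [hDn]; linarith only [this]
    have c3 : 0 ≤ p * (1 - r) * (1 - p) * (1 - r) :=
      mul_nonneg (mul_nonneg (mul_nonneg hp0 (by linarith)) (by linarith)) (by linarith)
    have c4 : 0 ≤ Dn * (1 - p) * (1 - r) - p * (1 - r) * (n - 1 + p + r - p * r) := by
      have hid4 : Dn * (1 - p) * (1 - r) - p * (1 - r) * (n - 1 + p + r - p * r) =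
          (1 - r) * (2 - p * (n + 2) * (1 + r * (1 - p))) := by rw [hDn]; ring
      rw [hid4]
      exact mul_nonneg (by linarith) (regimeB_ii p r n hn hp0 hp1 hr0 hr1 hB)
    have hsum : 0 ≤ Dn * (P - (p + (1 - p) * r * g)) - p * (1 - r) * (ENub - 2) := by
      rw [hid]
      have := mul_nonneg ha₁0 c1
      have := mul_nonneg ha₂0 c2
      have := mul_nonneg hc0 c3
      have h4 := mul_nonneg hd0 c4
      linarith only [mul_nonneg ha₁0 c1, mul_nonneg ha₂0 c2, mul_nonneg hc0 c3, h4]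
    -- `p(1−r)(ENub − 2) ≥ 0`
    have hEN2 : 0 ≤ p * (1 - r) * (ENub - 2) :=
      mul_nonneg (mul_nonneg hp0 (by linarith only [hr1])) (by linarith only [hEN, hENle])
    have hfin : 0 ≤ Dn * (P - (p + (1 - p) * r * g)) := by linarith only [hsum, hEN2]
    have := (mul_nonneg_iff_of_pos_left hDnpos).mp hfin
    linarith only [this]

end EarAtObserver

end Quant

end Summit.CriticalPhenomena.PercolationContinuityZ3.Theorems
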